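import Literature.Computability.Complexity.NTIMEPadding
import HarnessLib

/-!
# The exponential witness clock with affine exponent: `x ↦ ⟨x, 1^{c' · 2^{a|x|^k + b} + c''}⟩`

Literature / complexity toolkit, a variant of the clock program of `NTIMEPadding.lean`
(`ExpPad.clockProg`, clock length `c · 2^{|x|^k} + c`) for the derivation of Williams' Thm. 5.1
from Thm. 5.2 (`Williams2014Transfer.lean`): the clause-checking verifier cuts its witness (an
assignment table) at length `2^{m(n)} + 1` with `m(n) = a n² + b` an affine function of `n²`
dominating the index width `n + c log₂ n + c` of the succinct formula, so it needs the clock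
`x ↦ ⟨x, 1^{c' · 2^{a|x|^k + b} + c''}⟩` with independent constants `c'`, `c''` and an affine
exponent. Same registers and stages as `ExpPad.prog` / `ExpPad.clockProg`; the new stage
`ExpPad.affine a b` turns the unary power `1^{nᵏ}` into `1^{a nᵏ + b}` before the doubling loop,
and the output stage `ExpPad.finishClockGen c' c''` writes `c'` clock tokens per unit and `c''`
extra ones.

* `expClockGen c' c'' a k b x = boolPair x (1^{c' · 2^{a|x|^k + b} + c''})`;
* `ExpPad.clockProgGen`, `ExpPad.runs_clockProgGen` (exact cost `ExpPad.cClockGen`),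
  `ExpPad.exists_cClockGen_le` (`≤ C · 2^{a nᵏ + b} + C` for `1 ≤ k`, `1 ≤ a`);
* **`exists_timeComputable_expClockGen`**: `TimeComputable id id` in time
  `C · 2^{a nᵏ + b} + C` (`1 ≤ k`, `1 ≤ a`).

## References

* S. Arora, B. Barak, *Computational Complexity: A Modern Approach*, CUP 2009, §1.3, §2.6.2.
* T. Nipkow, G. Klein, *Concrete Semantics with Isabelle/HOL*, Springer 2014, Ch. 7.
-/

namespace Literature.Computability.Complexity

open _root_.Computability

/-- **The exponential witness clock with affine exponent**
`expClockGen c' c'' a k b x = ⟨x, 1^{c' · 2^{a|x|^k + b} + c''}⟩`. [folklore] -/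
def expClockGen (c' c'' a k b : ℕ) (x : List Bool) : List Bool :=
  boolPair x (List.replicate (c' * 2 ^ (a * x.length ^ k + b) + c'') true)

/-- Length of the clock word. [folklore] -/
@[simp] theorem length_expClockGen (c' c'' a k b : ℕ) (x : List Bool) :
    (expClockGen c' c'' a k b x).length =
      2 * x.length + 2 + (c' * 2 ^ (a * x.length ^ k + b) + c'') := by
  simp [expClockGen]

/-- The components of the clock word. [folklore] -/
@[simp] theorem boolUnpair_expClockGen (c' c'' a k b : ℕ) (x : List Bool) :
    boolUnpair (expClockGen c' c'' a k b x) =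
      (x, List.replicate (c' * 2 ^ (a * x.length ^ k + b) + c'') true) := by
  simp [expClockGen]

namespace ExpPad

open ACom

/-! ### The affine stage -/

/-- `pushOnesQ c`: push `c` tokens `1` on the scratch register `q`. [folklore] -/
def pushOnesQ : ℕ → Prog
  | 0 => skip
  | c + 1 => push .q true ;; pushOnesQ c

/-- Effect and cost of `pushOnesQ c`: `q := 1ᶜ ++ q` in `c` steps. [folklore] -/
theorem runs_pushOnesQ (i xr u u2 p q e f o : List Bool) : ∀ c : ℕ,
    Runs (pushOnesQ c) (mk i xr u u2 p q e f o) (mk i xr u u2 p (un c ++ q) e f o) c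
  | 0 => by simpa [pushOnesQ, un] using Runs.skip (mk i xr u u2 p q e f o)
  | c + 1 => by
    have h1 : Runs (push Rg.q true) (mk i xr u u2 p q e f o)
        (mk i xr u u2 p (true :: q) e f o) 1 := Runs.push' (by simp)
    have h2 := runs_pushOnesQ i xr u u2 p (true :: q) e f o c
    refine (h1.seq h2).of_eq ?_ (by omega)
    simp [un, List.replicate_succ']

/-- Effect and cost of the multiplication loop `loop p (pushOnesQ a)`: for `p = 1^P`,
`q := 1^{a P} ++ q`, `p := []`, in `(a + 2) P + 1` steps. [folklore] -/
theorem runs_mulOnesQ (i xr u u2 q e f o : List Bool) (a P : ℕ) :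
    Runs (loop .p fun _ => pushOnesQ a) (mk i xr u u2 (un P) q e f o)
      (mk i xr u u2 [] (un (a * P) ++ q) e f o) ((a + 2) * P + 1) := by
  have h := runs_loop_inv (k := Rg.p) (f := fun _ => pushOnesQ a)
    (fun done rest => mk i xr u u2 rest (un (a * done.length) ++ q) e f o)
    (fun _ _ => True) a
    (fun _ _ _ => rfl)
    (fun done x rest _ => ⟨trivial, by
      rw [update_mk_p]
      refine (runs_pushOnesQ i xr u u2 rest (un (a * done.length) ++ q) e f o a).of_eq ?_ le_rfl
      simp only [List.length_cons, un, ← List.append_assoc, ← List.replicate_add]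
      congr 2
      ring⟩)
    (un P) [] trivial
  simpa [un] using h

/-- `affine a b`: `p := 1^{a P + b}` for `p = 1^P` (through the scratch register `q`).
[folklore] -/
def affine (a b : ℕ) : Prog := (loop .p fun _ => pushOnesQ a) ;; pushOnesQ b ;; pour .q .p

/-- Effect and cost of `affine a b`. [folklore] -/
theorem runs_affine (i xr u u2 e f o : List Bool) (a b P : ℕ) :
    Runs (affine a b) (mk i xr u u2 (un P) [] e f o) (mk i xr u u2 (un (a * P + b)) [] e f o)
      (((a + 2) * P + 1) + b + (3 * (a * P + b) + 1)) := by
  unfold affine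
  have h1 := runs_mulOnesQ i xr u u2 [] e f o a P
  simp only [List.append_nil] at h1
  have h2 := runs_pushOnesQ i xr u u2 [] (un (a * P)) e f o b
  have h12 : un b ++ un (a * P) = un (a * P + b) := by
    simp only [un, ← List.replicate_add]
    congr 1
    ring
  rw [h12] at h2
  have h3 := runs_pour (Γ := Bool) (a := Rg.q) (b := Rg.p) (by decide)
    (mk i xr u u2 [] (un (a * P + b)) e f o)
  have h3' : Runs (pour Rg.q Rg.p) (mk i xr u u2 [] (un (a * P + b)) e f o)
      (mk i xr u u2 (un (a * P + b)) [] e f o) (3 * (a * P + b) + 1) := by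
    simpa [un] using h3
  exact (h1.seq (h2.seq h3')).of_eq rfl (by omega)

/-! ### The output stage with two constants -/

/-- `finishClockGen c' c''`: write the clock `1^{c' E + c''}` (from `e = 1^E`), the separator and
the doubled payload; clear `u`. [folklore] -/
def finishClockGen (c' c'' : ℕ) : Prog :=
  (loop .e fun _ => pushOnes c') ;; pushOnes c'' ;; push .out true ;; push .out false ;;
    (loop .xr fun b => push .out b ;; push .out b) ;; clear .u

/-- Effect and cost of `finishClockGen c' c''`. [folklore] -/
theorem runs_finishClockGen (c' c'' : ℕ) (x : List Bool) (n E : ℕ) :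
    Runs (finishClockGen c' c'') (mk [] x.reverse (un n) [] [] [] (un E) [] [])
      (mk [] [] [] [] [] [] [] [] (boolPair x (un (c' * E + c''))))
      (((c' + 2) * E + 1) + c'' + 1 + 1 + (4 * x.length + 1) + (2 * n + 1)) := by
  unfold finishClockGen
  have h1 := runs_mulOnes [] x.reverse (un n) [] [] [] [] [] c' E
  simp only [List.append_nil] at h1
  have h2 := runs_pushOnes [] x.reverse (un n) [] [] [] [] [] (un (c' * E)) c''
  have h12 : un c'' ++ un (c' * E) = un (c' * E + c'') := by
    simp only [un, ← List.replicate_add]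
    congr 1
    ring
  rw [h12] at h2
  have h3 : Runs (push Rg.out true) (mk [] x.reverse (un n) [] [] [] [] [] (un (c' * E + c'')))
      (mk [] x.reverse (un n) [] [] [] [] [] (true :: un (c' * E + c''))) 1 := Runs.push' (by simp)
  have h4 : Runs (push Rg.out false)
      (mk [] x.reverse (un n) [] [] [] [] [] (true :: un (c' * E + c'')))
      (mk [] x.reverse (un n) [] [] [] [] [] (false :: true :: un (c' * E + c''))) 1 :=
    Runs.push' (by simp)
  have h5 := runs_dblOut [] (un n) [] [] [] [] [] (false :: true :: un (c' * E + c'')) x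
  have h6 := runs_clear (Γ := Bool) Rg.u
    (mk [] [] (un n) [] [] [] [] []
      ((x.flatMap fun b => [b, b]) ++ false :: true :: un (c' * E + c'')))
  simp only [mk_u, update_mk_u, un, List.length_replicate] at h6
  have := h1.seq (h2.seq (h3.seq (h4.seq (h5.seq h6))))
  refine this.of_eq ?_ (by omega)
  simp [boolPair, un]

/-! ### The whole program -/

/-- **The clock program with affine exponent.** [folklore] -/
def clockProgGen (c' c'' a k b : ℕ) : Prog :=
  split ;; push .p true ;; powLoop k ;; affine a b ;; push .e true ;; (loop .p fun _ => dbl) ;;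
    finishClockGen c' c''

/-- Cost of the program on inputs of length `n`. [folklore] -/
def cClockGen (c' c'' a k b n : ℕ) : ℕ :=
  (4 * n + 1) + 1 + cPow n k + (((a + 2) * n ^ k + 1) + b + (3 * (a * n ^ k + b) + 1)) + 1 +
    cExp (a * n ^ k + b) 1 +
    (((c' + 2) * 2 ^ (a * n ^ k + b) + 1) + c'' + 1 + 1 + (4 * n + 1) + (2 * n + 1))

/-- **Effect and cost of the program**: from the input store holding `x` to the output store
holding `expClockGen c' c'' a k b x`, within `cClockGen c' c'' a k b |x|` steps. [folklore] -/
theorem runs_clockProgGen (c' c'' a k b : ℕ) (x : List Bool) :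
    Runs (clockProgGen c' c'' a k b) (AStore.single .inp x)
      (AStore.single .out (expClockGen c' c'' a k b x)) (cClockGen c' c'' a k b x.length) := by
  rw [single_inp, single_out]
  unfold clockProgGen cClockGen
  have h1 := runs_split x
  have h2 : Runs (push Rg.p true) (mk [] x.reverse (un x.length) [] [] [] [] [] [])
      (mk [] x.reverse (un x.length) [] (un 1) [] [] [] []) 1 := Runs.push' (by simp [un])
  have h3 := runs_powLoop [] x.reverse [] [] [] x.length k
  have h4 := runs_affine [] x.reverse (un x.length) [] [] [] [] a b (x.length ^ k)
  have h5 : Runs (push Rg.e true)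
      (mk [] x.reverse (un x.length) [] (un (a * x.length ^ k + b)) [] [] [] [])
      (mk [] x.reverse (un x.length) [] (un (a * x.length ^ k + b)) [] (un 1) [] []) 1 :=
    Runs.push' (by simp [un])
  have h6 := runs_expLoop [] x.reverse (un x.length) [] [] [] (a * x.length ^ k + b) 1
  simp only [one_mul] at h6
  have h7 := runs_finishClockGen c' c'' x x.length (2 ^ (a * x.length ^ k + b))
  have := h1.seq (h2.seq (h3.seq (h4.seq (h5.seq (h6.seq h7)))))
  refine this.of_eq ?_ (by omega)
  simp [expClockGen, un]

/-! ### The time bound -/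

/-- Closed form of the total cost. [folklore] -/
theorem cClockGen_add_one_eq (c' c'' a k b n : ℕ) :
    cClockGen c' c'' a k b n + 1 =
      cPow n k + (c' + 12) * 2 ^ (a * n ^ k + b) + (8 * a + 2) * n ^ k + 8 * b + 10 * n +
        c'' + 2 := by
  have h := cExp_eq (a * n ^ k + b) 1
  have h1 : 1 ≤ 2 ^ (a * n ^ k + b) := Nat.one_le_two_pow
  have e1 : (c' + 2) * 2 ^ (a * n ^ k + b) =
      c' * 2 ^ (a * n ^ k + b) + 2 * 2 ^ (a * n ^ k + b) := by ring
  have e2 : (c' + 12) * 2 ^ (a * n ^ k + b) =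
      c' * 2 ^ (a * n ^ k + b) + 12 * 2 ^ (a * n ^ k + b) := by ring
  have e3 : (a + 2) * n ^ k = a * n ^ k + 2 * n ^ k := by ring
  have e4 : (8 * a + 2) * n ^ k = 8 * (a * n ^ k) + 2 * n ^ k := by ring
  unfold cClockGen
  rw [e1, e2, e3, e4]
  omega

/-- **The program runs in time `O(2^{a nᵏ + b})`** (`1 ≤ k`, `1 ≤ a`). [folklore] -/
theorem exists_cClockGen_le (c' c'' a k b : ℕ) (hk : 1 ≤ k) (ha : 1 ≤ a) :
    ∃ C : ℕ, ∀ n : ℕ, cClockGen c' c'' a k b n + 1 ≤ C * 2 ^ (a * n ^ k + b) + C := by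
  open Polynomial in
  obtain ⟨c₀, hc₀⟩ := TimeConstructible.exists_poly_le_two_pow_pow
    (cPowPoly k + Polynomial.C (8 * a + 2) * X ^ k + Polynomial.C 10 * X +
      Polynomial.C (8 * b + c'' + 2)) hk
  refine ⟨c₀ + (c' + 12), fun n => ?_⟩
  have h := hc₀ n
  simp only [eval_add, eval_mul, eval_C, eval_pow, eval_X, eval_cPowPoly] at h
  have hmono : 2 ^ (n ^ k) ≤ 2 ^ (a * n ^ k + b) :=
    Nat.pow_le_pow_right Nat.two_pos (le_add_right (Nat.le_mul_of_pos_left _ ha))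
  have hc : c₀ * 2 ^ (n ^ k) ≤ c₀ * 2 ^ (a * n ^ k + b) := Nat.mul_le_mul_left c₀ hmono
  have e3 : (c₀ + (c' + 12)) * 2 ^ (a * n ^ k + b) =
      c₀ * 2 ^ (a * n ^ k + b) + (c' + 12) * 2 ^ (a * n ^ k + b) := by ring
  rw [cClockGen_add_one_eq, e3]
  omega

end ExpPad

/-! ### The clock is computable in exponential time -/

open ExpPad in
/-- **The clock with affine exponent is computed within `cClockGen … |x| + 1` steps** (the
structured program `ExpPad.clockProgGen` compiled by `ACom.exists_computesInTime`). [folklore] -/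
theorem exists_computesInTime_expClockGen (c' c'' a k b : ℕ) :
    ∃ M : Turing.TM2ComputableAux Bool Bool,
      ComputesInTime (id : List Bool → List Bool) id (expClockGen c' c'' a k b)
        (fun x => cClockGen c' c'' a k b x.length + 1) M :=
  ACom.exists_computesInTime (clockProgGen c' c'' a k b) .inp .out id id
    (expClockGen c' c'' a k b) (fun x => cClockGen c' c'' a k b x.length)
    (runs_clockProgGen c' c'' a k b)

/-- **`expClockGen c' c'' a k b` is computable in time `C · 2^{a nᵏ + b} + C`** (`1 ≤ k`,
`1 ≤ a`). [folklore] -/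
theorem exists_timeComputable_expClockGen (c' c'' : ℕ) {a k : ℕ} (b : ℕ) (hk : 1 ≤ k)
    (ha : 1 ≤ a) :
    ∃ C : ℕ, TimeComputable (id : List Bool → List Bool) id (expClockGen c' c'' a k b)
      (fun n => C * 2 ^ (a * n ^ k + b) + C) := by
  obtain ⟨C, hC⟩ := ExpPad.exists_cClockGen_le c' c'' a k b hk ha
  obtain ⟨M, hM⟩ := exists_computesInTime_expClockGen c' c'' a k b
  exact ⟨C, M, hM.mono fun x => hC x.length⟩

end Literature.Computability.Complexity
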